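import Summits.ResolutionOfSingularities.ResolutionOfSingularities.Theorems.FrobeniusLadderFInjectiveMacaulayficationF108ConsumableHolds

/-!
# [OURS · L1 W4.5a] The class theorems of `…F108ClassRow` made UNCONDITIONAL by `F108Consumable_holds`

✓ p680734 `…F108ClassRow` proved (B″), the F-half row, the two-sided census letter and its transport along origin-fixing coordinate
changes CONDITIONALLY on the OURS interface predicate `(hF : F108Consumable k n)`; ✓ p687854 `F108Consumable_holds` proves that
predicate for every field and every `n`.  This file records the four statements WITHOUT the hypothesis (one `exact` each):
`affineBlowup_fullCl_of_convenient`, ★ `fHalfRow_of_convenient`, ★ `pointFloorRow_of_convenient`, `pointFloorRow_of_convenient_of_ringEquiv`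
— for `f` prime, CONVENIENT, weakly non-degenerate along every positive weight, `x̄ᵢ ≠ 0`, regular off the vertex (+ the elementary per-bed
chart/Fedder data for the two-sided letter).  Seat res-L1-toric-fan g0.  AI-written; weaker than expert review.  Resolution of singularities in
positive characteristic is NOT proved by any of this; no census row of a specific bed is asserted here.
-/

set_option linter.dupNamespace false

noncomputable section

namespace Summit.ResolutionOfSingularities.ResolutionOfSingularities.Theorems.FInjectiveMacaulayfication.F108ClassRow

open CategoryTheory CategoryTheory.Limits AlgebraicGeometry TopologicalSpace IsLocalRing MvPolynomial
open Literature.AlgebraicGeometry.Resolution Literature.AlgebraicGeometry.Resolution.BoubakriGreuelMarkwig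
open Summit.ResolutionOfSingularities.ResolutionOfSingularities.Theorems.FInjectiveMacaulayfication
open SliceableCentre

variable (k : Type) [Field k] {n : ℕ}

/-- **(B″) for every convenient weakly non-degenerate isolated hypersurface point, unconditionally**: `affineBlowup_fullCl_of_F108Consumable`
with `hF := F108Consumable_holds k n`. [OURS · class theorem; cite: IshiiSingularities2018, Thm. 4.4.23 and Cor. 4.4.25] -/
theorem affineBlowup_fullCl_of_convenient (p : ℕ) [Fact p.Prime] [IsAlgClosed k] [CharP k p]
    (f : MvPolynomial (Fin n) k) (hfp : Prime f) (hconv : ∀ j : Fin n, ∃ N : ℕ, 0 < N ∧ MvPolynomial.coeff (Finsupp.single j N) f ≠ 0)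
    (hWND : ∀ w : Fin n → ℝ, (∀ i, 0 < w i) → IsWeaklyNondegenerateAlong w (f : MvPowerSeries (Fin n) k))
    (hXne : ∀ v : Fin n, Ideal.Quotient.mk (Ideal.span {f}) (X v) ≠ 0)
    (hreg : ∀ x : Spec (.of (MvPolynomial (Fin n) k ⧸ Ideal.span {f})),
      ¬ Ideal.span (Set.range fun j : Fin n => Ideal.Quotient.mk (Ideal.span {f}) (X j)) ≤ x.asIdeal → IsRegularLocalRing (Localization.AtPrime x.asIdeal)) :
    ∃ A : Finset (Fin n →₀ ℕ), (∀ j ∈ (Finset.univ : Finset (Fin n)), ∃ N : ℕ, Finsupp.single j N ∈ A) ∧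
      ∀ y : ↥(affineBlowup (Ideal.span ((fun e : Fin n →₀ ℕ => Ideal.Quotient.mk (Ideal.span {f}) (monomial e (1 : k))) '' (A : Set (Fin n →₀ ℕ))))),
        FullCl p ((affineBlowup (Ideal.span ((fun e : Fin n →₀ ℕ => Ideal.Quotient.mk (Ideal.span {f}) (monomial e (1 : k))) '' (A : Set (Fin n →₀ ℕ))))).presheaf.stalk y) :=
  affineBlowup_fullCl_of_F108Consumable k p (F108Consumable_holds k n) f hfp hconv hWND hXne hreg

/-- ★ **THE F-HALF AT CLASS LEVEL, UNCONDITIONAL** (the point floor of a prime, convenient, weakly non-degenerate isolated hypersurface point is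
CURED): `fHalfRow_of_F108Consumable` with `hF := F108Consumable_holds k n`. [OURS · class theorem; cite: IshiiSingularities2018, Thm. 4.4.23] [cite: StacksProject, Tag 080A] -/
theorem fHalfRow_of_convenient (p : ℕ) [Fact p.Prime] [IsAlgClosed k] [CharP k p] (hn : 0 < n)
    (f : MvPolynomial (Fin n) k) (hfp : Prime f) (hconv : ∀ j : Fin n, ∃ N : ℕ, 0 < N ∧ MvPolynomial.coeff (Finsupp.single j N) f ≠ 0)
    (hWND : ∀ w : Fin n → ℝ, (∀ i, 0 < w i) → IsWeaklyNondegenerateAlong w (f : MvPowerSeries (Fin n) k))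
    (hXne : ∀ v : Fin n, Ideal.Quotient.mk (Ideal.span {f}) (X v) ≠ 0)
    (hreg : ∀ x : Spec (.of (MvPolynomial (Fin n) k ⧸ Ideal.span {f})),
      ¬ Ideal.span (Set.range fun j : Fin n => Ideal.Quotient.mk (Ideal.span {f}) (X j)) ≤ x.asIdeal → IsRegularLocalRing (Localization.AtPrime x.asIdeal))
    (v : Spec (.of (MvPolynomial (Fin n) k ⧸ Ideal.span {f})))
    (hvm : v.asIdeal = Ideal.span (Set.range fun j : Fin n => Ideal.Quotient.mk (Ideal.span {f}) (X j))) :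
    ∀ (S' : Scheme.{0}) (gS : S' ⟶ Spec ((Spec (.of (MvPolynomial (Fin n) k ⧸ Ideal.span {f}))).presheaf.stalk v)),
      IsBlowup gS ((affineBlowup.idealSheaf (Ideal.span (Set.range fun j : Fin n => Ideal.Quotient.mk (Ideal.span {f}) (X j)))).comap
        ((Spec (.of (MvPolynomial (Fin n) k ⧸ Ideal.span {f}))).fromSpecStalk v)) →
      ∃ 𝓚 : S'.IdealSheafData, 𝓚 ≠ ⊥ ∧
        (∀ s ∈ (𝓚.support : Set S'), gS.base s = closedPoint ((Spec (.of (MvPolynomial (Fin n) k ⧸ Ideal.span {f}))).presheaf.stalk v)) ∧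
        ∀ (S'' : Scheme.{0}) (π : S'' ⟶ S'), IsBlowup π 𝓚 → ∀ s : S'', FullCl p (S''.presheaf.stalk s) :=
  fHalfRow_of_F108Consumable k p (F108Consumable_holds k n) hn f hfp hconv hWND hXne hreg v hvm

/-- ★ **THE TWO-SIDED CENSUS ROW AT CLASS LEVEL, UNCONDITIONAL: LEGAL ∧ NOT FULL ∧ CURED** from the class hypotheses and the elementary
per-bed chart/Fedder data: `pointFloorRow_of_F108Consumable` with `hF := F108Consumable_holds k n`. [OURS · class theorem; cite: Fedder1983, Thm. 1.12]
[cite: IshiiSingularities2018, Thm. 4.4.23] -/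
theorem pointFloorRow_of_convenient (p : ℕ) [Fact p.Prime] [IsAlgClosed k] [CharP k p] (hn : 0 < n)
    (f : MvPolynomial (Fin n) k) (hfp : Prime f) (hconv : ∀ j : Fin n, ∃ N : ℕ, 0 < N ∧ MvPolynomial.coeff (Finsupp.single j N) f ≠ 0)
    (hWND : ∀ w : Fin n → ℝ, (∀ i, 0 < w i) → IsWeaklyNondegenerateAlong w (f : MvPowerSeries (Fin n) k))
    (hXne : ∀ v : Fin n, Ideal.Quotient.mk (Ideal.span {f}) (X v) ≠ 0)
    (hreg : ∀ x : Spec (.of (MvPolynomial (Fin n) k ⧸ Ideal.span {f})),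
      ¬ Ideal.span (Set.range fun j : Fin n => Ideal.Quotient.mk (Ideal.span {f}) (X j)) ≤ x.asIdeal → IsRegularLocalRing (Localization.AtPrime x.asIdeal))
    (μ : Fin n → ℕ) (gθ : Fin n → MvPolynomial (Fin n) k)
    (hθ : ∀ i : Fin n, aeval (fun j : Fin n => if j = i then (X i : MvPolynomial (Fin n) k) else X j * X i) f = X i ^ μ i * gθ i)
    (hfX : ∀ i : Fin n, f ∉ Ideal.span {(X i : MvPolynomial (Fin n) k)}) (hgX : ∀ i : Fin n, gθ i ∉ Ideal.span {(X i : MvPolynomial (Fin n) k)})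
    (hf0 : constantCoeff f = 0) (i₀ : Fin n) (hc : constantCoeff (gθ i₀) = 0)
    (hfed : gθ i₀ ^ (p - 1) ∈ Ideal.span (Set.range fun j : Fin n => (X j : MvPolynomial (Fin n) k) ^ p))
    (v : Spec (.of (MvPolynomial (Fin n) k ⧸ Ideal.span {f})))
    (hvm : v.asIdeal = Ideal.span (Set.range fun j : Fin n => Ideal.Quotient.mk (Ideal.span {f}) (X j)))
    (hsing : v ∉ Scheme.regularLocus (Spec (.of (MvPolynomial (Fin n) k ⧸ Ideal.span {f}))))
    (S' : Scheme.{0}) (gS : S' ⟶ Spec ((Spec (.of (MvPolynomial (Fin n) k ⧸ Ideal.span {f}))).presheaf.stalk v))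
    (hgS : IsBlowup gS ((affineBlowup.idealSheaf (Ideal.span (Set.range fun j : Fin n => Ideal.Quotient.mk (Ideal.span {f}) (X j)))).comap
      ((Spec (.of (MvPolynomial (Fin n) k ⧸ Ideal.span {f}))).fromSpecStalk v))) :
    (((affineBlowup.idealSheaf (Ideal.span (Set.range fun j : Fin n => Ideal.Quotient.mk (Ideal.span {f}) (X j)))).comap
        ((Spec (.of (MvPolynomial (Fin n) k ⧸ Ideal.span {f}))).fromSpecStalk v)) ≠ ⊥ ∧
      ((((affineBlowup.idealSheaf (Ideal.span (Set.range fun j : Fin n => Ideal.Quotient.mk (Ideal.span {f}) (X j)))).comap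
        ((Spec (.of (MvPolynomial (Fin n) k ⧸ Ideal.span {f}))).fromSpecStalk v)).support :
          Set (Spec ((Spec (.of (MvPolynomial (Fin n) k ⧸ Ideal.span {f}))).presheaf.stalk v))) ⊆
        (Scheme.regularLocus (Spec ((Spec (.of (MvPolynomial (Fin n) k ⧸ Ideal.span {f}))).presheaf.stalk v)))ᶜ) ∧
      (∀ s : S', gS.base s ≠ closedPoint _ → s ∈ Scheme.regularLocus S') ∧ (∀ s : S', CMCl (S'.presheaf.stalk s))) ∧
    (∃ s : S', gS.base s = closedPoint _ ∧ ¬ FullCl p (S'.presheaf.stalk s)) ∧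
    (∃ 𝓚 : S'.IdealSheafData, 𝓚 ≠ ⊥ ∧ (∀ s ∈ (𝓚.support : Set S'), gS.base s = closedPoint _) ∧
      ∀ (S'' : Scheme.{0}) (π : S'' ⟶ S'), IsBlowup π 𝓚 → ∀ s : S'', FullCl p (S''.presheaf.stalk s)) :=
  pointFloorRow_of_F108Consumable k p (F108Consumable_holds k n) hn f hfp hconv hWND hXne hreg μ gθ hθ hfX hgX hf0 i₀ hc hfed v hvm hsing S' gS hgS

/-- **The unconditional two-sided row along an origin-fixing coordinate change**: `pointFloorRow_of_F108Consumable_of_ringEquiv` with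
`hF := F108Consumable_holds k n`. [OURS · class theorem; cite: GortzWedhorn2020, (13.19)] -/
theorem pointFloorRow_of_convenient_of_ringEquiv (p : ℕ) [Fact p.Prime] [IsAlgClosed k] [CharP k p] (hn : 0 < n)
    (φ : MvPolynomial (Fin n) k ≃+* MvPolynomial (Fin n) k)
    (h₁ : ∀ i : Fin n, constantCoeff (φ (X i)) = 0) (h₂ : ∀ i : Fin n, constantCoeff (φ.symm (X i)) = 0)
    (f f' : MvPolynomial (Fin n) k) (hff' : φ f = f') (hfp : Prime f') (hconv : ∀ j : Fin n, ∃ N : ℕ, 0 < N ∧ MvPolynomial.coeff (Finsupp.single j N) f' ≠ 0)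
    (hWND : ∀ w : Fin n → ℝ, (∀ i, 0 < w i) → IsWeaklyNondegenerateAlong w (f' : MvPowerSeries (Fin n) k))
    (hXne : ∀ v : Fin n, Ideal.Quotient.mk (Ideal.span {f'}) (X v) ≠ 0)
    (hreg : ∀ x : Spec (.of (MvPolynomial (Fin n) k ⧸ Ideal.span {f'})),
      ¬ Ideal.span (Set.range fun j : Fin n => Ideal.Quotient.mk (Ideal.span {f'}) (X j)) ≤ x.asIdeal → IsRegularLocalRing (Localization.AtPrime x.asIdeal))
    (μ : Fin n → ℕ) (gθ : Fin n → MvPolynomial (Fin n) k)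
    (hθ : ∀ i : Fin n, aeval (fun j : Fin n => if j = i then (X i : MvPolynomial (Fin n) k) else X j * X i) f' = X i ^ μ i * gθ i)
    (hfX : ∀ i : Fin n, f' ∉ Ideal.span {(X i : MvPolynomial (Fin n) k)}) (hgX : ∀ i : Fin n, gθ i ∉ Ideal.span {(X i : MvPolynomial (Fin n) k)})
    (hf0 : constantCoeff f' = 0) (i₀ : Fin n) (hc : constantCoeff (gθ i₀) = 0)
    (hfed : gθ i₀ ^ (p - 1) ∈ Ideal.span (Set.range fun j : Fin n => (X j : MvPolynomial (Fin n) k) ^ p))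
    (hsing : ∀ v : Spec (.of (MvPolynomial (Fin n) k ⧸ Ideal.span {f'})),
      v.asIdeal = Ideal.span (Set.range fun j : Fin n => Ideal.Quotient.mk (Ideal.span {f'}) (X j)) →
      v ∉ Scheme.regularLocus (Spec (.of (MvPolynomial (Fin n) k ⧸ Ideal.span {f'})))) :
    ∀ (v' : Spec (.of (MvPolynomial (Fin n) k ⧸ Ideal.span {f}))),
      v'.asIdeal = Ideal.span (Set.range fun j : Fin n => Ideal.Quotient.mk (Ideal.span {f}) (X j)) →
      ∀ (S' : Scheme.{0}) (g₁ : S' ⟶ Spec ((Spec (.of (MvPolynomial (Fin n) k ⧸ Ideal.span {f}))).presheaf.stalk v')),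
        IsBlowup g₁ ((affineBlowup.idealSheaf (Ideal.span (Set.range fun j : Fin n => Ideal.Quotient.mk (Ideal.span {f}) (X j)))).comap
          ((Spec (.of (MvPolynomial (Fin n) k ⧸ Ideal.span {f}))).fromSpecStalk v')) →
        (((affineBlowup.idealSheaf (Ideal.span (Set.range fun j : Fin n => Ideal.Quotient.mk (Ideal.span {f}) (X j)))).comap
            ((Spec (.of (MvPolynomial (Fin n) k ⧸ Ideal.span {f}))).fromSpecStalk v')) ≠ ⊥ ∧
          ((((affineBlowup.idealSheaf (Ideal.span (Set.range fun j : Fin n => Ideal.Quotient.mk (Ideal.span {f}) (X j)))).comap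
            ((Spec (.of (MvPolynomial (Fin n) k ⧸ Ideal.span {f}))).fromSpecStalk v')).support :
              Set (Spec ((Spec (.of (MvPolynomial (Fin n) k ⧸ Ideal.span {f}))).presheaf.stalk v'))) ⊆
            (Scheme.regularLocus (Spec ((Spec (.of (MvPolynomial (Fin n) k ⧸ Ideal.span {f}))).presheaf.stalk v')))ᶜ) ∧
          (∀ s : S', g₁.base s ≠ closedPoint _ → s ∈ Scheme.regularLocus S') ∧ (∀ s : S', CMCl (S'.presheaf.stalk s))) ∧
        (∃ s : S', g₁.base s = closedPoint _ ∧ ¬ FullCl p (S'.presheaf.stalk s)) ∧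
        (∃ 𝓚 : S'.IdealSheafData, 𝓚 ≠ ⊥ ∧ (∀ s ∈ (𝓚.support : Set S'), g₁.base s = closedPoint _) ∧
          ∀ (S'' : Scheme.{0}) (π : S'' ⟶ S'), IsBlowup π 𝓚 → ∀ s : S'', FullCl p (S''.presheaf.stalk s)) :=
  pointFloorRow_of_F108Consumable_of_ringEquiv k p (F108Consumable_holds k n) hn φ h₁ h₂ f f' hff' hfp hconv hWND hXne hreg μ gθ hθ hfX hgX hf0
    i₀ hc hfed hsing

end Summit.ResolutionOfSingularities.ResolutionOfSingularities.Theorems.FInjectiveMacaulayfication.F108ClassRow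

end
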